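import Summits.CriticalPhenomena.PercolationContinuityZ3.Theorems.PercNearOneGluingAdditiveGluingBystanderLemma3
import Literature.Probability.Percolation.ClusterBoundary
import Literature.Probability.LatticeModels.ProdBernoulliIndependence
import Literature.Probability.Percolation.PercolationProofs
import HarnessLib

/-!
# Goodness with two relays via the bystander inequality: the `|A ∖ b| ≤ 2` kernel of `stub_goodStep`

Crux `PercNearOneGluing.AdditiveGluing` (stmt-CriticalPhenomena-4576), line `subuniform-dead-pocket-maximum`,
`stub_goodStep` (siege k42, variation "C1 kernel first"); file 4/4.

**Theorem (`stub_goodCardLeThree_k42`).** Kozma–Nitzan goodness (arXiv:2401.12397 §3.2, in the skeleton's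
linear selection form) holds UNCONDITIONALLY for every quadruple `(w, A, o, b)` with `b ∈ A`, `A.card ≤ 3`:
for every level `t` with `1 − t ≤ μ(a ↔ b)` on `A` and every selection `sel W ∈ A`,
`μ(o ↔ A, o ↮ b) + Σ_{W ∋ o, W ∩ A = ∅} μ(C(o) = W) · μ((sel W ↔ b in Wᶜ)ᶜ) ≤ t`.
This is exactly the conclusion of `stub_goodStep` restricted to `A.card ≤ 3` (no induction hypothesis, no low
neighbour): the lead's kernel `C1` ("Pen ≤ Y₁ − X", Lines/subuniform-dead-pocket-maximum-goodstep-c1.md §3)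
and with it `GOOD(2) = Kozma–Nitzan Thm 1 + dead-pocket penalty`, previously open.

Proof (`bystander_good_two_relays`): order the two relays, `μ(a₁ ↔ b) ≤ μ(a₂ ↔ b)`.  Per dead pocket `W`
(Markov property `bystander_real_cluster_mul_offConn_compl`),
`μ(C(o)=W) μ((sel W ↔ b in Wᶜ)ᶜ) = μ(C(o)=W, sel W ↮ b) ≤ μ(C(o)=W, a₁↮b) + d(W)⁺`,
`d(W) = μ(C(o)=W, a₁↔b, a₁↮a₂) − μ(C(o)=W, a₂↔b, a₁↮a₂)` (`bystander_pocket_sel_le`).  Summing, the positive parts are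
`Σ_{W ∈ R⁺} d(W)` over the RE-ORDERING pockets `R⁺ = {d > 0}` — a family with no monotonicity — and
**Kozma–Nitzan's Lemma 3 for the bystander event `{o ↔ a₂} ∪ {C(o) ∈ R⁺}`** (`bystander_lemma3`, file 3, from the
bystander-BHK inequality of file 2) bounds it by `μ(o↔a₂, a₂↔b, a₁↮a₂) − μ(o↔a₂, a₁↔b, a₁↮a₂)`.  Finally
`{C(o) dead, a₁↮b}`, `{o ↔ A, o ↮ b, a₁ ↮ b}` and `{o↔a₂, a₂↔b, a₁↮a₂}` are disjoint sub-events of `{a₁ ↮ b}`,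
of probability `1 − μ(a₁ ↔ b) ≤ t`.
-/

noncomputable section

namespace Summit.CriticalPhenomena.PercolationContinuityZ3.Theorems

open Literature.Probability.Percolation
open MeasureTheory
open Literature.Probability.LatticeModels (prodBernoulli prodBernoulli_real_inter_of_determinedBy)
open scoped Classical

/-! ### Pockets: the Markov property in the skeleton's vocabulary -/

section Pockets

variable {n : ℕ}

/-- **On `{C(o) = W}` a connection between two vertices outside `W` avoids `W`:**
`{x ↔ b} = {x ↔ b in Wᶜ}` there (an open path from `x ∉ W` entering `W` would put `x` into `C(o)`). [folklore] -/
theorem bystander_openConn_iff_offConn_of_cluster {W : Finset (Fin n)} {o x b : Fin n} {ω : BondConfig (Fin n)}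
    (hK : openCluster ω o = ↑W) (hx : x ∉ W) :
    ω ∈ openConn x b ↔ ω ∈ openConnIn ((↑W : Set (Fin n))ᶜ) x b := by
  refine ⟨fun h => ?_, fun h => openConnIn_subset_openConn _ x b h⟩
  have hp := DCT16.pathIn_univ_of_reachable (show (openGraph ω).Reachable x b from h)
  rcases hp.exit_or (R := ((↑W : Set (Fin n))ᶜ)) (fun h' => hx (Finset.mem_coe.1 h')) with h' | h'
  · exact DCT16.mem_openConnIn_of_pathIn (h'.mono Set.inter_subset_left)
  · obtain ⟨a, c, ha, hc, -, hac, -⟩ := h'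
    exfalso
    have hcW : c ∈ (↑W : Set (Fin n)) := not_not.1 hc
    have hc' : c ∈ openCluster ω o := by rw [hK]; exact hcW
    have ha' : a ∈ openCluster ω o :=
      SimpleGraph.Reachable.trans hc' (SimpleGraph.Adj.reachable hac.symm)
    rw [hK] at ha'
    exact ha ha'

/-- **Markov property of the pocket**: `μ(C(o) = W) · μ((x ↔ b in Wᶜ)ᶜ) = μ(C(o) = W, x ↮ b)` for
`x ∉ W` (the events `{C(o) = W}` and `{x ↔ b in Wᶜ}` use disjoint sets of pairs). [folklore] -/
theorem bystander_real_cluster_mul_offConn_compl (w : Sym2 (Fin n) → unitInterval) (W : Finset (Fin n))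
    (o x b : Fin n) (hx : x ∉ W) :
    (prodBernoulli w).real {ω : BondConfig (Fin n) | openCluster ω o = (↑W : Set (Fin n))} *
        (prodBernoulli w).real (openConnIn ((↑W : Set (Fin n))ᶜ) x b)ᶜ =
      (prodBernoulli w).real
        ({ω : BondConfig (Fin n) | openCluster ω o = (↑W : Set (Fin n))} ∩ (openConn x b)ᶜ) := by
  have hset : ({ω : BondConfig (Fin n) | openCluster ω o = (↑W : Set (Fin n))} ∩ (openConn x b)ᶜ) =
      clusterIs o W ∩ (openConnIn ((↑W : Set (Fin n))ᶜ) x b)ᶜ := by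
    ext ω
    simp only [Set.mem_inter_iff, Set.mem_setOf_eq, Set.mem_compl_iff, mem_clusterIs]
    constructor
    · rintro ⟨hK, hnot⟩
      exact ⟨hK, fun h => hnot (openConnIn_subset_openConn _ x b h)⟩
    · rintro ⟨hK, hnot⟩
      exact ⟨hK, fun h => hnot ((bystander_openConn_iff_offConn_of_cluster hK hx).1 h)⟩
  rw [hset]
  set F : Finset (Sym2 (Fin n)) := (Set.toFinite (edgesTouching (↑W : Set (Fin n)))).toFinset
    with hF
  have hFc : (↑F : Set (Sym2 (Fin n))) = edgesTouching (↑W : Set (Fin n)) := by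
    rw [hF, Set.Finite.coe_toFinset]
  symm
  refine prodBernoulli_real_inter_of_determinedBy w F ?_ ?_ MeasurableSet.of_discrete
    MeasurableSet.of_discrete
  · rw [hFc]; exact determinedBy_clusterIs o W
  · rw [hFc]
    exact (DCT16.determinedBy_openConnIn _ x b le_rfl).compl.mono
      (disjoint_edgesTouching_compl_sym2 _).subset_compl_left

/-- Off `{a₁ ↮ a₂}` the events `{a₁ ↔ b}` and `{a₂ ↔ b}` agree: for every event `S`,
`μ(S, a₁ ↔ b) − μ(S, a₂ ↔ b) = μ(S, a₁ ↔ b, a₁ ↮ a₂) − μ(S, a₂ ↔ b, a₁ ↮ a₂)`. [folklore] -/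
theorem bystander_real_inter_openConn_sub_eq (w : Sym2 (Fin n) → unitInterval) (S : Set (BondConfig (Fin n)))
    (a₁ a₂ b : Fin n) :
    (prodBernoulli w).real (S ∩ openConn a₁ b) - (prodBernoulli w).real (S ∩ openConn a₂ b) =
      (prodBernoulli w).real (S ∩ openConn a₁ b ∩ (openConn a₁ a₂)ᶜ) -
        (prodBernoulli w).real (S ∩ openConn a₂ b ∩ (openConn a₁ a₂)ᶜ) := by
  have hDm : MeasurableSet ((openConn a₁ a₂)ᶜ : Set (BondConfig (Fin n))) := MeasurableSet.of_discrete
  have hagree : (S ∩ openConn a₁ b) \ (openConn a₁ a₂)ᶜ = (S ∩ openConn a₂ b) \ (openConn a₁ a₂)ᶜ := by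
    ext ω
    simp only [Set.mem_sdiff, Set.mem_inter_iff, Set.mem_compl_iff, not_not]
    constructor
    · rintro ⟨⟨hS, h1⟩, h2⟩
      exact ⟨⟨hS, SimpleGraph.Reachable.trans (SimpleGraph.Reachable.symm h2) h1⟩, h2⟩
    · rintro ⟨⟨hS, h1⟩, h2⟩
      exact ⟨⟨hS, SimpleGraph.Reachable.trans h2 h1⟩, h2⟩
  have hs1 := measureReal_inter_add_sdiff (μ := prodBernoulli w) (s := S ∩ openConn a₁ b) hDm
  have hs2 := measureReal_inter_add_sdiff (μ := prodBernoulli w) (s := S ∩ openConn a₂ b) hDm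
  rw [hagree] at hs1
  linarith

/-- **Per-pocket bound.** For a dead pocket `W` and a selected relay `sel W ∈ {a₁, a₂, b}`,
`μ(C(o)=W, sel W ↮ b) ≤ μ(C(o)=W, a₁ ↮ b) + (μ(C(o)=W, a₁↔b, a₁↮a₂) − μ(C(o)=W, a₂↔b, a₁↮a₂))⁺`. [folklore] -/
theorem bystander_pocket_sel_le (w : Sym2 (Fin n) → unitInterval) (W : Finset (Fin n)) (o a₁ a₂ b x : Fin n)
    (hx : x = a₁ ∨ x = a₂ ∨ x = b) :
    (prodBernoulli w).real ({ω : BondConfig (Fin n) | openCluster ω o = (↑W : Set (Fin n))} ∩ (openConn x b)ᶜ) ≤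
      (prodBernoulli w).real ({ω : BondConfig (Fin n) | openCluster ω o = (↑W : Set (Fin n))} ∩ (openConn a₁ b)ᶜ) +
        max 0 ((prodBernoulli w).real
            ({ω : BondConfig (Fin n) | openCluster ω o = (↑W : Set (Fin n))} ∩ openConn a₁ b ∩ (openConn a₁ a₂)ᶜ) -
          (prodBernoulli w).real
            ({ω : BondConfig (Fin n) | openCluster ω o = (↑W : Set (Fin n))} ∩ openConn a₂ b ∩ (openConn a₁ a₂)ᶜ)) := by
  set μ := prodBernoulli w with hμ
  set S : Set (BondConfig (Fin n)) := {ω | openCluster ω o = (↑W : Set (Fin n))} with hS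
  have hmax : 0 ≤ max 0 (μ.real (S ∩ openConn a₁ b ∩ (openConn a₁ a₂)ᶜ) -
      μ.real (S ∩ openConn a₂ b ∩ (openConn a₁ a₂)ᶜ)) := le_max_left _ _
  rcases hx with rfl | rfl | rfl
  · linarith
  · -- `x = a₂`: `μ(S, a₂↮b) = μ(S) − μ(S, a₂↔b)` and `μ(S, a₁↮b) = μ(S) − μ(S, a₁↔b)`
    have h1 := measureReal_inter_add_sdiff (μ := μ) (s := S)
      (MeasurableSet.of_discrete (s := (openConn x b : Set (BondConfig (Fin n)))))
    have h2 := measureReal_inter_add_sdiff (μ := μ) (s := S)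
      (MeasurableSet.of_discrete (s := (openConn a₁ b : Set (BondConfig (Fin n)))))
    rw [Set.sdiff_eq] at h1 h2
    have h3 := bystander_real_inter_openConn_sub_eq w S a₁ x b
    have h4 := le_max_right 0 (μ.real (S ∩ openConn a₁ b ∩ (openConn a₁ x)ᶜ) -
      μ.real (S ∩ openConn x b ∩ (openConn a₁ x)ᶜ))
    rw [← hμ] at h3
    linarith
  · -- `x = b`: `{b ↮ b} = ∅`
    have h0 : μ.real (S ∩ (openConn x x)ᶜ) = 0 := by
      have : (S ∩ (openConn x x)ᶜ : Set (BondConfig (Fin n))) = ∅ :=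
        Set.eq_empty_of_forall_notMem fun ω ⟨_, h⟩ => h (SimpleGraph.Reachable.refl x)
      rw [this, measureReal_empty]
    rw [h0]
    exact add_nonneg measureReal_nonneg hmax

/-- The pocket fibres `{C(o) = W}` are pairwise disjoint (also after intersecting with anything). [folklore] -/
theorem bystander_pairwiseDisjoint_cluster_inter (o : Fin n) (T : Finset (Fin n) → Set (BondConfig (Fin n)))
    (𝓕 : Finset (Finset (Fin n))) :
    (↑𝓕 : Set (Finset (Fin n))).PairwiseDisjoint fun W =>
      {ω : BondConfig (Fin n) | openCluster ω o = (↑W : Set (Fin n))} ∩ T W := by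
  intro W _ W' _ hWW'
  rw [Function.onFun, Set.disjoint_left]
  rintro ω ⟨hW, -⟩ ⟨hW', -⟩
  exact hWW' (Finset.coe_injective (hW.symm.trans hW'))

/-- Summing a pocket family: `Σ_{W ∈ 𝓕} μ(C(o) = W, T) = μ(C(o) ∈ 𝓕, T)`. [folklore] -/
theorem bystander_sum_real_cluster_inter (w : Sym2 (Fin n) → unitInterval) (o : Fin n)
    (T : Set (BondConfig (Fin n))) (𝓕 : Finset (Finset (Fin n))) :
    ∑ W ∈ 𝓕, (prodBernoulli w).real ({ω : BondConfig (Fin n) | openCluster ω o = (↑W : Set (Fin n))} ∩ T) =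
      (prodBernoulli w).real
        ({ω : BondConfig (Fin n) | openCluster ω o ∈ {S : Set (Fin n) | ∃ W ∈ 𝓕, (↑W : Set (Fin n)) = S}} ∩ T) := by
  have hU : ({ω : BondConfig (Fin n) | openCluster ω o ∈ {S : Set (Fin n) | ∃ W ∈ 𝓕, (↑W : Set (Fin n)) = S}} ∩ T) =
      ⋃ W ∈ 𝓕, ({ω : BondConfig (Fin n) | openCluster ω o = (↑W : Set (Fin n))} ∩ T) := by
    ext ω
    simp only [Set.mem_inter_iff, Set.mem_setOf_eq, Set.mem_iUnion, exists_prop]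
    constructor
    · rintro ⟨⟨W, hW, hWK⟩, hT⟩
      exact ⟨W, hW, hWK.symm, hT⟩
    · rintro ⟨W, hW, hWK, hT⟩
      exact ⟨⟨W, hW, hWK.symm⟩, hT⟩
  rw [hU, measureReal_biUnion_finset (bystander_pairwiseDisjoint_cluster_inter o (fun _ => T) 𝓕)
    (fun _ _ => MeasurableSet.of_discrete)]

end Pockets

/-! ### Goodness with two relays -/

section GoodTwoRelays

variable {n : ℕ}

/-- **GOOD with at most two relays besides the target** (the `|A ∖ b| ≤ 2` kernel of
`stub_goodStep`, unconditional; `o ∉ A` is not even needed): if `b ∈ A`, `A ⊆ {a₁, a₂, b}` with `a₁, a₂ ∈ A` and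
`μ(a₁ ↔ b) ≤ μ(a₂ ↔ b)`, then for every level `t` admissible on `A` and every selection `sel` into `A`,
`Φ(A) + Σ_{W dead} μ(C(o) = W) · μ((sel W ↔ b in Wᶜ)ᶜ) ≤ t`.
Proof: per pocket, `μ(C(o)=W, sel W ↮ b) ≤ μ(C(o)=W, a₁↮b) + d(W)⁺` with
`d(W) = μ(C(o)=W, a₁↔b, a₁↮a₂) − μ(C(o)=W, a₂↔b, a₁↮a₂)`; Kozma–Nitzan's Lemma 3 for the bystander event
`{o ↔ a₂} ∪ {C(o) ∈ R⁺}`, `R⁺ = {W dead | d(W) > 0}` (`bystander_lemma3`) gives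
`Σ_{R⁺} d(W) ≤ μ(o↔a₂, a₂↔b, a₁↮a₂) − μ(o↔a₂, a₁↔b, a₁↮a₂)`; and the three events
`{C(o) dead, a₁↮b}`, `{o ↔ A, o ↮ b, a₁ ↮ b}`, `{o↔a₂, a₂↔b, a₁↮a₂}` are disjoint sub-events of `{a₁ ↮ b}`,
whose probability is `1 − μ(a₁ ↔ b) ≤ t`. [folklore] -/
theorem bystander_good_two_relays (w : Sym2 (Fin n) → unitInterval) (A : Finset (Fin n)) (o b a₁ a₂ : Fin n)
    (hb : b ∈ A) (ha₁ : a₁ ∈ A) (ha₂ : a₂ ∈ A) (hA : ∀ x ∈ A, x = a₁ ∨ x = a₂ ∨ x = b)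
    (hle : (prodBernoulli w).real (openConn a₁ b) ≤ (prodBernoulli w).real (openConn a₂ b))
    (t : ℝ) (sel : Finset (Fin n) → Fin n) (hsel : ∀ W, sel W ∈ A)
    (ht : ∀ a ∈ A, 1 - t ≤ (prodBernoulli w).real (openConn a b)) :
    (prodBernoulli w).real ((⋃ a ∈ A, openConn o a) ∩ (openConn o b)ᶜ)
      + ∑ W ∈ (Finset.univ : Finset (Finset (Fin n))).filter (fun W => o ∈ W ∧ Disjoint W A),
          (prodBernoulli w).real {ω : BondConfig (Fin n) | openCluster ω o = (W : Set (Fin n))}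
            * (prodBernoulli w).real (openConnIn ((W : Set (Fin n))ᶜ) (sel W) b)ᶜ
      ≤ t := by
  set μ := prodBernoulli w with hμ
  set filt := (Finset.univ : Finset (Finset (Fin n))).filter (fun W => o ∈ W ∧ Disjoint W A) with hfilt
  set κ : Finset (Fin n) → Set (BondConfig (Fin n)) :=
    fun W => {ω : BondConfig (Fin n) | openCluster ω o = (W : Set (Fin n))} with hκ
  set D : Set (BondConfig (Fin n)) := (openConn a₁ a₂)ᶜ with hD
  set d : Finset (Fin n) → ℝ :=
    fun W => μ.real (κ W ∩ openConn a₁ b ∩ D) - μ.real (κ W ∩ openConn a₂ b ∩ D) with hd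
  set Rp := filt.filter (fun W => 0 < d W) with hRp
  have hmemfilt : ∀ W ∈ filt, o ∈ W ∧ Disjoint W A := fun W hW => (Finset.mem_filter.1 hW).2
  -- Step 1: the penalty, pocket by pocket
  have hpen : ∀ W ∈ filt, μ.real (κ W) * μ.real (openConnIn ((W : Set (Fin n))ᶜ) (sel W) b)ᶜ ≤
      μ.real (κ W ∩ (openConn a₁ b)ᶜ) + max 0 (d W) := by
    intro W hW
    have hselW : sel W ∉ W := fun h => Finset.disjoint_left.1 (hmemfilt W hW).2 h (hsel W)
    rw [bystander_real_cluster_mul_offConn_compl w W o (sel W) b hselW]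
    exact bystander_pocket_sel_le w W o a₁ a₂ b (sel W) (hA _ (hsel W))
  have hsum1 : ∑ W ∈ filt, μ.real (κ W) * μ.real (openConnIn ((W : Set (Fin n))ᶜ) (sel W) b)ᶜ ≤
      ∑ W ∈ filt, μ.real (κ W ∩ (openConn a₁ b)ᶜ) + ∑ W ∈ filt, max 0 (d W) := by
    rw [← Finset.sum_add_distrib]
    exact Finset.sum_le_sum hpen
  -- Step 2: the two sums are probabilities of pocket families
  have hS1 : ∑ W ∈ filt, μ.real (κ W ∩ (openConn a₁ b)ᶜ) =
      μ.real ({ω : BondConfig (Fin n) | openCluster ω o ∈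
        {S : Set (Fin n) | ∃ W ∈ filt, (↑W : Set (Fin n)) = S}} ∩ (openConn a₁ b)ᶜ) :=
    bystander_sum_real_cluster_inter w o _ filt
  have hpos : ∑ W ∈ filt, max 0 (d W) = ∑ W ∈ Rp, d W := by
    have hRs : ∑ W ∈ Rp, d W = ∑ W ∈ filt, if 0 < d W then d W else 0 := by
      rw [hRp]; exact Finset.sum_filter _ _
    rw [hRs]
    refine Finset.sum_congr rfl fun W _ => ?_
    by_cases h : 0 < d W
    · rw [if_pos h, max_eq_right h.le]
    · rw [if_neg h, max_eq_left (not_lt.1 h)]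
  set 𝓡 : Set (Set (Fin n)) := {S : Set (Fin n) | ∃ W ∈ Rp, (↑W : Set (Fin n)) = S} with h𝓡
  have hRp_sub : ∀ W ∈ Rp, W ∈ filt := fun W hW => (Finset.mem_filter.1 hW).1
  have hdsum : ∑ W ∈ Rp, d W =
      μ.real ({ω : BondConfig (Fin n) | openCluster ω o ∈ 𝓡} ∩ (openConn a₁ b ∩ D)) -
        μ.real ({ω : BondConfig (Fin n) | openCluster ω o ∈ 𝓡} ∩ (openConn a₂ b ∩ D)) := by
    simp only [hd]
    rw [Finset.sum_sub_distrib]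
    have e1 := bystander_sum_real_cluster_inter w o (openConn a₁ b ∩ D) Rp
    have e2 := bystander_sum_real_cluster_inter w o (openConn a₂ b ∩ D) Rp
    simp only [Set.inter_assoc] at e1 e2 ⊢
    rw [e1, e2]
  -- Step 3: Kozma–Nitzan's Lemma 3 for the bystander event of `R⁺`
  have h𝓡a₁ : ∀ S ∈ 𝓡, a₁ ∉ S := by
    rintro S ⟨W, hW, rfl⟩ h
    exact Finset.disjoint_left.1 (hmemfilt W (hRp_sub W hW)).2 (Finset.mem_coe.1 h) ha₁
  have hKL := bystander_lemma3 w o a₁ a₂ b 𝓡 h𝓡a₁ hle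
  -- the bystander event splits: `{o ↔ a₂}` and `{C(o) ∈ 𝓡}` are disjoint (`a₂ ∈ A`, pockets avoid `A`)
  have hdisj : Disjoint (openConn o a₂ : Set (BondConfig (Fin n)))
      {ω : BondConfig (Fin n) | openCluster ω o ∈ 𝓡} := by
    rw [Set.disjoint_left]
    rintro ω ho₂ ⟨W, hW, hWK⟩
    have : a₂ ∈ (↑W : Set (Fin n)) := by rw [hWK]; exact ho₂
    exact Finset.disjoint_left.1 (hmemfilt W (hRp_sub W hW)).2 (Finset.mem_coe.1 this) ha₂
  have hsplit : ∀ T : Set (BondConfig (Fin n)),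
      μ.real (T ∩ (openConn o a₂ ∪ {ω | openCluster ω o ∈ 𝓡}) ∩ D) =
        μ.real (T ∩ openConn o a₂ ∩ D) + μ.real ({ω | openCluster ω o ∈ 𝓡} ∩ (T ∩ D)) := by
    intro T
    have hset : T ∩ (openConn o a₂ ∪ {ω | openCluster ω o ∈ 𝓡}) ∩ D =
        (T ∩ openConn o a₂ ∩ D) ∪ ({ω | openCluster ω o ∈ 𝓡} ∩ (T ∩ D)) := by
      ext ω
      simp only [Set.mem_inter_iff, Set.mem_union, Set.mem_setOf_eq]
      tauto
    rw [hset, measureReal_union ?_ MeasurableSet.of_discrete]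
    exact Set.disjoint_left.2 fun ω ⟨⟨_, h1⟩, _⟩ ⟨h2, _⟩ => Set.disjoint_left.1 hdisj h1 h2
  rw [hsplit, hsplit] at hKL
  -- Step 4: the live failure splits by `{a₁ ↔ b}`
  have hlive : μ.real ((⋃ a ∈ A, openConn o a) ∩ (openConn o b)ᶜ) ≤
      μ.real (openConn a₁ b ∩ openConn o a₂ ∩ D) +
        μ.real ((⋃ a ∈ A, openConn o a) ∩ (openConn o b)ᶜ ∩ (openConn a₁ b)ᶜ) := by
    have h := measureReal_inter_add_sdiff (μ := μ) (s := (⋃ a ∈ A, openConn o a) ∩ (openConn o b)ᶜ)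
      (MeasurableSet.of_discrete (s := (openConn a₁ b : Set (BondConfig (Fin n)))))
    rw [Set.sdiff_eq] at h
    have hsub : (⋃ a ∈ A, openConn o a) ∩ (openConn o b)ᶜ ∩ openConn a₁ b ⊆
        openConn a₁ b ∩ openConn o a₂ ∩ D := by
      rintro ω ⟨⟨hU, hob⟩, h1⟩
      simp only [Set.mem_iUnion, exists_prop] at hU
      obtain ⟨a, haA, hoa⟩ := hU
      have hoa₂ : ω ∈ openConn o a₂ := by
        rcases hA a haA with rfl | rfl | rfl
        · exact absurd (SimpleGraph.Reachable.trans hoa h1) hob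
        · exact hoa
        · exact absurd hoa hob
      refine ⟨⟨h1, hoa₂⟩, fun h12 => hob ?_⟩
      exact SimpleGraph.Reachable.trans hoa₂ (SimpleGraph.Reachable.trans (SimpleGraph.Reachable.symm h12) h1)
    have := measureReal_mono (μ := μ) hsub
    linarith
  -- Step 5: three disjoint sub-events of `{a₁ ↮ b}`
  set S₁ := {ω : BondConfig (Fin n) | openCluster ω o ∈
      {S : Set (Fin n) | ∃ W ∈ filt, (↑W : Set (Fin n)) = S}} ∩ (openConn a₁ b)ᶜ with hS₁
  set S₂ := (⋃ a ∈ A, openConn o a) ∩ (openConn o b)ᶜ ∩ (openConn a₁ b)ᶜ with hS₂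
  set S₃ := (openConn a₂ b : Set (BondConfig (Fin n))) ∩ openConn o a₂ ∩ D with hS₃
  have hdead : ∀ ω ∈ S₁, ∀ a ∈ A, ω ∉ openConn o a := by
    rintro ω ⟨⟨W, hW, hWK⟩, -⟩ a haA hoa
    have : a ∈ (↑W : Set (Fin n)) := by rw [hWK]; exact hoa
    exact Finset.disjoint_left.1 (hmemfilt W hW).2 (Finset.mem_coe.1 this) haA
  have h12 : Disjoint S₁ S₂ := by
    rw [Set.disjoint_left]
    rintro ω h1 ⟨⟨hU, -⟩, -⟩
    simp only [Set.mem_iUnion, exists_prop] at hU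
    obtain ⟨a, haA, hoa⟩ := hU
    exact hdead ω h1 a haA hoa
  have h13 : Disjoint S₁ S₃ := by
    rw [Set.disjoint_left]
    rintro ω h1 ⟨⟨-, hoa₂⟩, -⟩
    exact hdead ω h1 a₂ ha₂ hoa₂
  have h23 : Disjoint S₂ S₃ := by
    rw [Set.disjoint_left]
    rintro ω ⟨⟨-, hob⟩, -⟩ ⟨⟨h2b, hoa₂⟩, -⟩
    exact hob (SimpleGraph.Reachable.trans hoa₂ h2b)
  have hsub : S₁ ∪ S₂ ∪ S₃ ⊆ (openConn a₁ b)ᶜ := by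
    rintro ω ((⟨-, h⟩ | ⟨-, h⟩) | ⟨⟨h2b, -⟩, hDω⟩)
    · exact h
    · exact h
    · exact fun h1 => hDω (SimpleGraph.Reachable.trans h1 (SimpleGraph.Reachable.symm h2b))
  have hunion : μ.real S₁ + μ.real S₂ + μ.real S₃ ≤ μ.real (openConn a₁ b)ᶜ := by
    rw [← measureReal_union h12 MeasurableSet.of_discrete,
      ← measureReal_union (Disjoint.union_left h13 h23) MeasurableSet.of_discrete]
    exact measureReal_mono hsub
  have hcompl : μ.real (openConn a₁ b)ᶜ = 1 - μ.real (openConn a₁ b) :=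
    probReal_compl_eq_one_sub MeasurableSet.of_discrete
  have hta₁ := ht a₁ ha₁
  -- assemble
  have hS1' : ∑ W ∈ filt, μ.real (κ W ∩ (openConn a₁ b)ᶜ) = μ.real S₁ := hS1
  calc μ.real ((⋃ a ∈ A, openConn o a) ∩ (openConn o b)ᶜ)
        + ∑ W ∈ filt, μ.real (κ W) * μ.real (openConnIn ((W : Set (Fin n))ᶜ) (sel W) b)ᶜ
      ≤ (μ.real (openConn a₁ b ∩ openConn o a₂ ∩ D) + μ.real S₂) + (μ.real S₁ + ∑ W ∈ Rp, d W) := by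
        rw [← hS1', ← hpos]; exact add_le_add hlive hsum1
    _ ≤ μ.real S₁ + μ.real S₂ + μ.real S₃ := by rw [hdsum]; linarith [hKL]
    _ ≤ t := by linarith

end GoodTwoRelays

section Wrapper

/-- **Registered sub-goal `stub_goodCardLeThree_k42`** (siege k42, the `|A ∖ b| ≤ 2` kernel of `stub_goodStep`,
UNCONDITIONAL — no induction hypothesis and no low-neighbour hypothesis needed): Kozma–Nitzan goodness of every
quadruple `(w, A, o, b)` with `b ∈ A ∌ o` and `A.card ≤ 3`, in the skeleton's linear selection form.  From
`bystander_good_two_relays` after choosing the worst relay `a₁` of `A ∖ b` and the remaining one `a₂`. [folklore] -/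
theorem stub_goodCardLeThree_k42 : ∀ (n : ℕ) (w : Sym2 (Fin n) → unitInterval) (A : Finset (Fin n)) (o b : Fin n), b ∈ A → o ∉ A → A.card ≤ 3 → ∀ (t : ℝ) (sel : Finset (Fin n) → Fin n), (∀ W, sel W ∈ A) → (∀ a ∈ A, 1 - t ≤ (prodBernoulli w).real (openConn a b)) → (prodBernoulli w).real ((⋃ a ∈ A, openConn o a) ∩ (openConn o b)ᶜ) + ∑ W ∈ (Finset.univ : Finset (Finset (Fin n))).filter (fun W => o ∈ W ∧ Disjoint W A), (prodBernoulli w).real {ω : BondConfig (Fin n) | openCluster ω o = (W : Set (Fin n))} * (prodBernoulli w).real (openConnIn ((W : Set (Fin n))ᶜ) (sel W) b)ᶜ ≤ t := by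
  intro n w A o b hb ho hcard t sel hsel ht
  -- choose `a₁, a₂ ∈ A` with `A ⊆ {a₁, a₂, b}` and `μ(a₁ ↔ b) ≤ μ(a₂ ↔ b)`
  obtain ⟨a₁, a₂, ha₁, ha₂, hA, hle⟩ : ∃ a₁ a₂ : Fin n, a₁ ∈ A ∧ a₂ ∈ A ∧
      (∀ x ∈ A, x = a₁ ∨ x = a₂ ∨ x = b) ∧
      (prodBernoulli w).real (openConn a₁ b) ≤ (prodBernoulli w).real (openConn a₂ b) := by
    set B := A.erase b with hB
    have hBcard : B.card ≤ 2 := by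
      rw [hB, Finset.card_erase_of_mem hb]; omega
    have hmemB : ∀ x, x ∈ B ↔ x ≠ b ∧ x ∈ A := fun x => Finset.mem_erase
    rcases B.eq_empty_or_nonempty with hBe | hBne
    · refine ⟨b, b, hb, hb, fun x hx => ?_, le_rfl⟩
      by_cases hxb : x = b
      · exact Or.inl hxb
      · have : x ∈ B := (hmemB x).2 ⟨hxb, hx⟩
        rw [hBe] at this
        exact absurd this (Finset.notMem_empty x)
    · obtain ⟨m, hmB, hmin⟩ :=
        B.exists_min_image (fun x => (prodBernoulli w).real (openConn x b)) hBne
      have hmA : m ∈ A := ((hmemB m).1 hmB).2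
      set C := B.erase m with hC
      have hCcard : C.card ≤ 1 := by
        rw [hC, Finset.card_erase_of_mem hmB]; omega
      have hmemC : ∀ x, x ∈ C ↔ x ≠ m ∧ x ∈ B := fun x => Finset.mem_erase
      rcases C.eq_empty_or_nonempty with hCe | hCne
      · refine ⟨m, m, hmA, hmA, fun x hx => ?_, le_rfl⟩
        by_cases hxb : x = b
        · exact Or.inr (Or.inr hxb)
        by_cases hxm : x = m
        · exact Or.inl hxm
        have : x ∈ C := (hmemC x).2 ⟨hxm, (hmemB x).2 ⟨hxb, hx⟩⟩
        rw [hCe] at this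
        exact absurd this (Finset.notMem_empty x)
      · obtain ⟨y, hyC⟩ := hCne
        have hyB : y ∈ B := ((hmemC y).1 hyC).2
        have hyA : y ∈ A := ((hmemB y).1 hyB).2
        refine ⟨m, y, hmA, hyA, fun x hx => ?_, hmin y hyB⟩
        by_cases hxb : x = b
        · exact Or.inr (Or.inr hxb)
        by_cases hxm : x = m
        · exact Or.inl hxm
        have hxC : x ∈ C := (hmemC x).2 ⟨hxm, (hmemB x).2 ⟨hxb, hx⟩⟩
        exact Or.inr (Or.inl (Finset.card_le_one.1 hCcard x hxC y hyC))
  exact bystander_good_two_relays w A o b a₁ a₂ hb ha₁ ha₂ hA hle t sel hsel ht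

end Wrapper

end Summit.CriticalPhenomena.PercolationContinuityZ3.Theorems
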